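import Summits.BirchSwinnertonDyer.BirchSwinnertonDyer.Theorems.KimAtThreeDeepUpperStubCounting
import HarnessLib

/-!
# Route `KimAtThreeKolyvagin` (rung W2), crux `DeepUpperAtThree`: Mazur–Rubin Thm. 4.4.3 —
# "sufficiently liftable Kolyvagin systems are STUB sections" — at a general modulus `p^m`

Cell `bsd-addord`, seat `bsd-addord-w2-c3` (D-0074 row B6), item `stmt-BirchSwinnertonDyer-19076`.
TOOL theorems on Kolyvagin systems of a finite discrete `Γ_K`-module killed by `p^m`, in the
SINGLE-MODULE currency (torsion subgroups of ONE Selmer group per level); no definition, no named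
fact, no `sorry`; nothing asserted about any curve.  Every arithmetic input (Poitou–Tate counts,
residual dual step, Chebotarev prime choice, local shape at Kolyvagin primes) is an explicit
HYPOTHESIS, as in n1011's `m = 1` theorem `CoreRankZero.apply_eq_zero_of_dualSelmerGroup_atLevel_ne_bot`.

WHY (the road to the last inline port of crux 19076).  `KimAtThreeDeepUpperOfPortsDevissage.
deepUpper_conclusion_of_ports_of_towerSurj` proves 19076 at a Kato-stratum row GRANTED published
facts, one port, and ONE new inline hypothesis `hStub`: the STUB at `∅`,
`g_∅ ∈ 3^{n₀} H¹_{𝓕_can}(ℚ, E[3^{k+1}]) + Sel`, `3^{n₀} = #H¹_{𝓕_can^*}`, for the generator `g` of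
`KS(E[3^{k+1}], 𝓕_can)` — Mazur–Rubin Thm. 4.4.1 (`Γ(𝓗′) = Γ(𝓗)`), printed under (H.4) (false at
`p = 3`), whose Case 3 needs Howard's App. B and `𝒳⁰` connected.  Their **Thm. 4.4.3** (p. 46:
"Suppose `κ ∈ KS(T)` is sufficiently liftable … a lifting `(T̃, 𝓕̃, 𝒫)` … of length `k̃ ≥ 2k − 1` …
Then `κ` is a global section of the subsheaf `𝓗′`") reaches the same conclusion by an induction
"on both `k` and `λ(n, T̄^*)`" whose only Chebotarev call has ONE class and ONE dual class (the
`p`-torsion multiple of `κ_n` doubles as the `T`-side class of Lemma 4.1.7 (iv)) — at `p = 3` the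
tree's two-class prime choice (Sakamoto Cor. 5.5, n1011 `PrimeChoice`) — and NO Howard / `𝒳⁰`.
The generator of `KS(E[3^{k+1}])` IS sufficiently liftable (Sakamoto Thm. 4.4 (1) at two depths +
n1011's injectivity at a core vertex) — the sibling glue; here is the theorem itself, the system of
`T/p^k` being the multiple `p^{m−k} κ` read in `H¹(K,T)[p^k] ≅ H¹(K, T/p^k)` (Lemma 4.1.1 (i)).

WHAT.  `StubLift.localization_nsmul_apply_eq_zero_of_stub` = Lemma 4.2.1 on `p^k`-torsion;
**`StubLift.nsmul_apply_mem_stub_of_liftable`** = Thm. 4.4.3: for every Kolyvagin system `κ` of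
`(T, 𝓕, 𝒫)`, every `k` with `2k ≤ m + 1` and every level `d`,
`p^{m−k} κ_d = #X(d)[p^k] • e` with `e ∈ H¹_{𝓕(d)}(K, T)[p^k]`, where `X(d)` is a companion family
(the dual Selmer groups, or their transport under a residual self-duality) entering only through
(count) `#H¹_{𝓕(d)}[p^k] = p^k · #X(d)[p^k]` (all `k ≤ m`, all levels: core rank one at every depth),
(drop) `#X(d𝔮)[p] < #X(d)[p]` when `p`-torsion classes of both sides are non-zero at `𝔮`, and
(choice) the two-class prime choice.  Cases as in print: Case 1 (`#X(d)[p^k] = p^j < p^k`) by the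
induction on `k` and the counting of the sibling file; Case 2 by the prime choice, the induction on
`#X(d)[p]`, and Lemma 4.2.1.
[cite: MazurRubin2004, Thm. 4.4.3 and proof (pp. 46–47); Lemma 4.2.1 (p. 40); Lemma 4.1.7 (iv) (p. 37); Cor. 4.4.5 (p. 47)]
[cite: Rubin2011, Thm. 2.8.4 (pp. 24–25); Prop. 2.6.1, Cor. 2.6.2 (pp. 22–23)] [cite: Sakamoto2024, Cor. 5.5 (p. 929)]
-/

set_option autoImplicit false
-- the Theorems namespace of a single-conjunct summit repeats the summit name by design (D-0017)
set_option linter.dupNamespace false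

noncomputable section

open scoped Classical NumberField ContRepresentation
open Function NumberField IsDedekindDomain
  Literature.NumberTheory.GaloisRepresentations
  Literature.NumberTheory.GaloisRepresentations.DiscreteGaloisModule Literature.NumberTheory.GaloisCohomology
  Summit.BirchSwinnertonDyer.Rank1Residual.GaloisImage
  Summit.BirchSwinnertonDyer.Rank1Residual.GaloisImage.CoreRankZero
  Summit.BirchSwinnertonDyer.BirchSwinnertonDyer.Theorems.KimAtThreeDeepUpperStubCounting.StubLift

universe u

namespace Summit.BirchSwinnertonDyer.BirchSwinnertonDyer.Theorems.KimAtThreeDeepUpperStubLiftable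

namespace StubLift

variable {K : Type u} [Field K] [NumberField K]
variable {M : Type u} [AddCommGroup M] [TopologicalSpace M] [DiscreteTopology M]
variable {ρ : DiscreteGaloisModule K M}

/-! ### §1 Mazur–Rubin Lemma 4.2.1 on `p^k`-torsion -/

/-- **Mazur–Rubin Lemma 4.2.1, read on `p^k`-torsion at a general modulus `p^m`.**  Let `𝔮 ∉ d`
be a Kolyvagin prime off `S` (so `𝓕(d)_𝔮 = H¹_ur(K_𝔮, M)`, whose `p^k`-torsion subgroups have
order `≤ p^k`), `H¹_ur ⊓ H¹_tr = 0` at `𝔮`, and `φ^{fs}_𝔮` admissible.  Write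
`N(d') = #X(d')[p^k]` for the companion family `X` (think: the dual Selmer groups), and assume the
core-rank-one counts `#H¹_{𝓕(d')}[p^k] = p^k · N(d')` at `d' = d, d𝔮` and `p^k ≤ N(d)` ("Case 2":
`λ(d, T^*) ≥ k`).  If the class `p^{m−k} κ_{d𝔮}` of a Kolyvagin system has the STUB SHAPE
`N(d𝔮) • e` with `e ∈ H¹_{𝓕(d𝔮)}[p^k]`, then `loc_𝔮(p^{m−k} κ_d) = 0`.  Proof (MR p. 40): with
`p^c = #loc_𝔮(H¹_{𝓕(d)}[p^k]) ≤ p^k ≤ N(d)` and `p^d = #loc^s_𝔮(H¹_{𝓕(d𝔮)}[p^k])`, the strict step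
gives `N(d𝔮)·p^c = N(d)·p^d`, so `p^d ≤ N(d𝔮)` kills the singular part of `N(d𝔮) • e`; then the
finite–singular relation and admissibility. [cite: MazurRubin2004, Lemma 4.2.1 (p. 40) and Lemma 4.1.6] -/
theorem localization_nsmul_apply_eq_zero_of_stub {p : ℕ} [hp : Fact p.Prime] {m : ℕ}
    {S : Finset (Place K)} {𝓕 : SelmerStructure ρ}
    (h𝓕 : 𝓕.IsUnramifiedOutside S) {D : KolyvaginDatum ρ}
    (hPS : ∀ q ∈ D.primes, (Sum.inr q : Place K) ∉ S) (hadm : D.IsAdmissible)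
    (hUT : ∀ q ∈ D.primes,
      unramifiedSubgroup (GaloisRep.toLocal q ρ) 1 ⊓ D.transverse (Sum.inr q) = ⊥)
    (hfin : ∀ d, Finite (D.atLevel 𝓕 d).selmerGroup)
    {M' : Type u} [AddCommGroup M'] [TopologicalSpace M'] [DiscreteTopology M']
    {ρ' : DiscreteGaloisModule K M'}
    (X : Finset (HeightOneSpectrum (𝓞 K)) → AddSubgroup (galoisCohomology ρ' 1))
    (hXfin : ∀ d, Finite (X d)) (hXp : ∀ d, ∀ y ∈ X d, p ^ m • y = 0)
    {κ : Finset (HeightOneSpectrum (𝓞 K)) → galoisCohomology ρ 1} (hκ : D.IsKolyvaginSystem 𝓕 κ)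
    {d : Finset (HeightOneSpectrum (𝓞 K))} (hd : D.IsLevel d) {q : HeightOneSpectrum (𝓞 K)}
    (hq : q ∈ D.primes) (hqd : q ∉ d) {k : ℕ}
    (hUk : ∀ C : AddSubgroup (galoisCohomology (GaloisRep.toLocal q ρ) 1),
      C ≤ unramifiedSubgroup (GaloisRep.toLocal q ρ) 1 → (∀ c ∈ C, p ^ k • c = 0) →
        Nat.card C ≤ p ^ k)
    (hcnt : Nat.card ↥((D.atLevel 𝓕 d).selmerGroup ⊓ (nsmulAddMonoidHom (p ^ k)).ker) =
      p ^ k * Nat.card ↥(X d ⊓ (nsmulAddMonoidHom (p ^ k)).ker))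
    (hcnt' : Nat.card ↥((D.atLevel 𝓕 (insert q d)).selmerGroup ⊓ (nsmulAddMonoidHom (p ^ k)).ker) =
      p ^ k * Nat.card ↥(X (insert q d) ⊓ (nsmulAddMonoidHom (p ^ k)).ker))
    (hbig : p ^ k ≤ Nat.card ↥(X d ⊓ (nsmulAddMonoidHom (p ^ k)).ker))
    {e : galoisCohomology ρ 1} (he : e ∈ (D.atLevel 𝓕 (insert q d)).selmerGroup)
    (hek : p ^ k • e = 0)
    (hκe : p ^ (m - k) • κ (insert q d) =
      Nat.card ↥(X (insert q d) ⊓ (nsmulAddMonoidHom (p ^ k)).ker) • e) :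
    galoisCohomology.localization ρ (Sum.inr q) 1 (p ^ (m - k) • κ d) = 0 := by
  haveI := hfin d
  haveI := hfin (insert q d)
  haveI hF1 : Finite ↥((D.atLevel 𝓕 d).selmerGroup ⊓ (nsmulAddMonoidHom (p ^ k)).ker) :=
    finite_inf_left _ _
  haveI hF2 : Finite ↥((D.atLevel 𝓕 (insert q d)).selmerGroup ⊓ (nsmulAddMonoidHom (p ^ k)).ker) :=
    finite_inf_left _ _
  haveI hFC : Finite ↥(((D.atLevel 𝓕 d).selmerGroup ⊓ (nsmulAddMonoidHom (p ^ k)).ker).map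
      (galoisCohomology.localization ρ (Sum.inr q) 1)) := finite_map _ _
  haveI hFB : Finite ↥(((D.atLevel 𝓕 (insert q d)).selmerGroup ⊓
      (nsmulAddMonoidHom (p ^ k)).ker).map (KolyvaginDatum.singularLocalization ρ q)) :=
    finite_map _ _
  haveI hFX : Finite ↥(X (insert q d) ⊓ (nsmulAddMonoidHom (p ^ k)).ker) := by
    haveI := hXfin (insert q d); exact finite_inf_left _ _
  have hp0 : 0 < p ^ k := pow_pos hp.out.pos _
  -- the strict step, counted: `p^k N(d𝔮) · #C = p^k N(d) · #B`
  have hstep := card_torsion_mul_card_loc_eq 𝓕 hUT hfin d hq (p ^ k)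
  rw [hcnt, hcnt'] at hstep
  -- `#C ≤ p^k`: `C = loc_𝔮(H¹_{𝓕(d)}[p^k])` is a `p^k`-torsion subgroup of `H¹_ur(K_𝔮, M) = 𝓕(d)_𝔮`
  have hCle : Nat.card ↥(((D.atLevel 𝓕 d).selmerGroup ⊓ (nsmulAddMonoidHom (p ^ k)).ker).map
      (galoisCohomology.localization ρ (Sum.inr q) 1)) ≤ p ^ k := by
    refine hUk _ ?_ ?_
    · rintro c hc
      obtain ⟨b, hb, rfl⟩ := AddSubgroup.mem_map.mp hc
      have hb1 := (SelmerStructure.mem_selmerGroup_iff _ _).1 (AddSubgroup.mem_inf.1 hb).1 (Sum.inr q)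
      rw [Level.atLevel_inr_of_not_mem D 𝓕 hqd, h𝓕.2 q (hPS q hq)] at hb1
      exact hb1
    · rintro c hc
      obtain ⟨b, hb, rfl⟩ := AddSubgroup.mem_map.mp hc
      have hb2 : p ^ k • b = 0 := by
        have h2 := (AddSubgroup.mem_inf.1 hb).2
        rw [AddMonoidHom.mem_ker, nsmulAddMonoidHom_apply] at h2
        exact h2
      rw [← map_nsmul, hb2, map_zero]
  have hCpos : 0 < Nat.card ↥(((D.atLevel 𝓕 d).selmerGroup ⊓ (nsmulAddMonoidHom (p ^ k)).ker).map
      (galoisCohomology.localization ρ (Sum.inr q) 1)) := Nat.card_pos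
  -- hence `#B ≤ N(d𝔮)` (pure arithmetic)
  have hBle : Nat.card ↥(((D.atLevel 𝓕 (insert q d)).selmerGroup ⊓
      (nsmulAddMonoidHom (p ^ k)).ker).map (KolyvaginDatum.singularLocalization ρ q)) ≤
      Nat.card ↥(X (insert q d) ⊓ (nsmulAddMonoidHom (p ^ k)).ker) := by
    revert hstep hCle hCpos hbig hp0
    generalize Nat.card ↥(((D.atLevel 𝓕 (insert q d)).selmerGroup ⊓
      (nsmulAddMonoidHom (p ^ k)).ker).map (KolyvaginDatum.singularLocalization ρ q)) = b
    generalize Nat.card ↥(((D.atLevel 𝓕 d).selmerGroup ⊓ (nsmulAddMonoidHom (p ^ k)).ker).map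
      (galoisCohomology.localization ρ (Sum.inr q) 1)) = c
    generalize Nat.card ↥(X (insert q d) ⊓ (nsmulAddMonoidHom (p ^ k)).ker) = y
    generalize Nat.card ↥(X d ⊓ (nsmulAddMonoidHom (p ^ k)).ker) = x
    generalize p ^ k = P
    intro hx hP h hc hc0
    have h' : y * c = x * b := by
      rw [mul_assoc, mul_assoc] at h
      exact Nat.eq_of_mul_eq_mul_left hP h
    by_contra hlt
    push Not at hlt
    have h1 : y * c ≤ y * P := Nat.mul_le_mul_left y hc
    have h2 : y * P < b * P := Nat.mul_lt_mul_of_pos_right hlt hP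
    have h3 : b * P ≤ b * x := Nat.mul_le_mul_left b hx
    have : y * c < x * b := by
      calc y * c < b * x := lt_of_le_of_lt h1 (lt_of_lt_of_le h2 h3)
        _ = x * b := mul_comm _ _
    omega
  -- `B` is killed by `p^k`, and `N(d𝔮)` is a power of `p` at least `#B`: so `N(d𝔮) • B = 0`
  have hBp : ∀ x ∈ ((D.atLevel 𝓕 (insert q d)).selmerGroup ⊓
      (nsmulAddMonoidHom (p ^ k)).ker).map (KolyvaginDatum.singularLocalization ρ q), p ^ k • x = 0 := by
    rintro x hx
    obtain ⟨b, hb, rfl⟩ := AddSubgroup.mem_map.mp hx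
    have hb2 : p ^ k • b = 0 := by
      have h2 := (AddSubgroup.mem_inf.1 hb).2
      rw [AddMonoidHom.mem_ker, nsmulAddMonoidHom_apply] at h2
      exact h2
    rw [← map_nsmul, hb2, map_zero]
  have hXG : ∀ y ∈ X (insert q d) ⊓ (nsmulAddMonoidHom (p ^ k)).ker, p ^ m • y = 0 := by
    intro y hy
    rw [AddSubgroup.mem_inf] at hy
    exact hXp _ y hy.1
  obtain ⟨ℓ, hℓ⟩ := exists_card_eq_prime_pow _ hXG
  have hBle' : Nat.card ↥(((D.atLevel 𝓕 (insert q d)).selmerGroup ⊓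
      (nsmulAddMonoidHom (p ^ k)).ker).map (KolyvaginDatum.singularLocalization ρ q)) ≤ p ^ ℓ := by
    rw [← hℓ]; exact hBle
  have heB : KolyvaginDatum.singularLocalization ρ q e ∈
      ((D.atLevel 𝓕 (insert q d)).selmerGroup ⊓ (nsmulAddMonoidHom (p ^ k)).ker).map
        (KolyvaginDatum.singularLocalization ρ q) := by
    refine AddSubgroup.mem_map_of_mem _ (AddSubgroup.mem_inf.2 ⟨he, ?_⟩)
    rw [AddMonoidHom.mem_ker, nsmulAddMonoidHom_apply]
    exact hek
  have hkill : Nat.card ↥(X (insert q d) ⊓ (nsmulAddMonoidHom (p ^ k)).ker) •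
      KolyvaginDatum.singularLocalization ρ q e = 0 := by
    rw [hℓ]
    exact nsmul_eq_zero_of_card_le_pow _ hBp hBle' heB
  -- the finite–singular relation, multiplied by `p^{m-k}`
  have hrel := hκ.fs_rel d hd q hq hqd
  have hrel' : KolyvaginDatum.singularLocalization ρ q (p ^ (m - k) • κ (insert q d)) =
      D.fsLocalization q (p ^ (m - k) • κ d) := by
    rw [map_nsmul, map_nsmul, hrel]
  rw [hκe, map_nsmul, hkill] at hrel'
  -- `loc_𝔮 (p^{m-k} κ_d)` is unramified and killed by `φ^{fs}_𝔮`: admissibility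
  have hmem : galoisCohomology.localization ρ (Sum.inr q) 1 (p ^ (m - k) • κ d) ∈
      unramifiedSubgroup (GaloisRep.toLocal q ρ) 1 := by
    have h := (SelmerStructure.mem_selmerGroup_iff _ _).mp
      (AddSubgroup.nsmul_mem _ (hκ.mem_selmerGroup d hd) (p ^ (m - k))) (Sum.inr q)
    rwa [Level.atLevel_inr_of_not_mem D 𝓕 hqd, h𝓕.2 q (hPS q hq)] at h
  have hR : D.fsLocalization q (p ^ (m - k) • κ d) =
      D.fs q (galoisCohomology.localization ρ (Sum.inr q) 1 (p ^ (m - k) • κ d)) := rfl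
  rw [hR] at hrel'
  have hinj := (hadm q hq).1
  have hx0 : (⟨_, hmem⟩ : unramifiedSubgroup (GaloisRep.toLocal q ρ) 1) = 0 := by
    apply hinj
    show D.fs q _ = D.fs q _
    simp only [ZeroMemClass.coe_zero, map_zero]
    exact hrel'.symm
  have hval := congrArg Subtype.val hx0
  rw [ZeroMemClass.coe_zero] at hval
  exact hval

/-! ### §2 Mazur–Rubin Thm. 4.4.3 in single-module currency -/

/-- **Mazur–Rubin Thm. 4.4.3 ("sufficiently liftable Kolyvagin systems are stub sections") at a
general modulus `p^m`, in the SINGLE-MODULE currency.**  Setting: `K` a number field, `p` a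
prime, `T` a finite discrete `Γ_K`-module with `p^m · H¹(K, T) = 0`; `𝓕` a Selmer structure
unramified outside `S`; a Kolyvagin datum `D` with primes off `S`, admissible comparison maps,
`H¹_ur ⊓ H¹_tr = 0` and `#C ≤ p^k` for the `p^k`-torsion subgroups `C ≤ H¹_ur(K_𝔮, T)` at its
primes (Rubin Ex. 1.9.7: `H¹_ur ≅ T/(Fr_𝔮 − 1)T ≅ ℤ/p^m`); a companion family `X(d) ≤ H¹(K, T′)`
(think: the dual Selmer groups `H¹_{𝓕(d)^*}(K, T^*)`, or their images in `H¹(K, T)` under a residual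
self-duality), finite and killed by `p^m`, with THREE inputs: (count) the core-rank-one counts at
every depth `#H¹_{𝓕(d)}[p^k] = p^k · #X(d)[p^k]` (Mazur–Rubin Thm. 4.1.13 with Lemma 4.1.1);
(drop) the residual dual step `#X(d𝔮)[p] < #X(d)[p]` when some `p`-torsion classes of `H¹_{𝓕(d)}` and
of `X(d)` are non-zero at `𝔮` (Lemma 4.1.7 (iv)); (choice) the two-class prime choice
(Prop. 3.6.1; at `p = 3` Sakamoto Cor. 5.5).  CONCLUSION, for every Kolyvagin system `κ` of
`(T, 𝓕, 𝒫)`, every `k` with `2k ≤ m + 1` and every level `d`: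
**`p^{m−k} κ_d ∈ #X(d)[p^k] · H¹_{𝓕(d)}[p^k]`** — i.e. the image of `κ` in
`KS(T/p^k) ⊂ ∏ H¹_{𝓕(d)}(K, T)[p^k]` is a section of the STUB subsheaf
`𝓗′(d) = 𝔪^{λ(d, T^*)} 𝓗(d)`, `p^{λ} = #X(d)[p^k]`, the Kolyvagin system of `T/p^k` being
"sufficiently liftable" to `T` of length `m ≥ 2k − 1` by construction.  Proof = Mazur–Rubin's
(p. 47), by induction on `k` and on `#X(d)[p]`: Case 1 (`#X(d)[p^k] < p^k`) by the induction on `k`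
and the counting `mem_map_nsmul_add_of_counts`; Case 2 (`#X(d)[p^k] ≥ p^k`) by the prime choice, the
induction on `#X(d)[p]` and Lemma 4.2.1 (`localization_nsmul_apply_eq_zero_of_stub`).  No (H.4),
no `𝒳⁰`-connectedness, no Howard. [cite: MazurRubin2004, Thm. 4.4.3 and its proof (pp. 46–47); Lemma 4.2.1 (p. 40); Cor. 4.4.5]
[cite: Sakamoto2024, Cor. 5.5 (p. 929)] -/
theorem nsmul_apply_mem_stub_of_liftable {p : ℕ} [hp : Fact p.Prime] {m : ℕ}
    (hV : ∀ c : galoisCohomology ρ 1, p ^ m • c = 0)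
    {S : Finset (Place K)} {𝓕 : SelmerStructure ρ} (h𝓕 : 𝓕.IsUnramifiedOutside S)
    {D : KolyvaginDatum ρ} (hPS : ∀ q ∈ D.primes, (Sum.inr q : Place K) ∉ S)
    (hadm : D.IsAdmissible)
    (hUT : ∀ q ∈ D.primes,
      unramifiedSubgroup (GaloisRep.toLocal q ρ) 1 ⊓ D.transverse (Sum.inr q) = ⊥)
    (hUk : ∀ q ∈ D.primes, ∀ k ≤ m, ∀ C : AddSubgroup (galoisCohomology (GaloisRep.toLocal q ρ) 1),
      C ≤ unramifiedSubgroup (GaloisRep.toLocal q ρ) 1 → (∀ c ∈ C, p ^ k • c = 0) →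
        Nat.card C ≤ p ^ k)
    (hfin : ∀ d, Finite (D.atLevel 𝓕 d).selmerGroup)
    {M' : Type u} [AddCommGroup M'] [TopologicalSpace M'] [DiscreteTopology M']
    {ρ' : DiscreteGaloisModule K M'}
    (X : Finset (HeightOneSpectrum (𝓞 K)) → AddSubgroup (galoisCohomology ρ' 1))
    (hXfin : ∀ d, Finite (X d)) (hXp : ∀ d, ∀ y ∈ X d, p ^ m • y = 0)
    (hcount : ∀ d, D.IsLevel d → ∀ k ≤ m,
      Nat.card ↥((D.atLevel 𝓕 d).selmerGroup ⊓ (nsmulAddMonoidHom (p ^ k)).ker) =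
        p ^ k * Nat.card ↥(X d ⊓ (nsmulAddMonoidHom (p ^ k)).ker))
    (hdrop : ∀ d, D.IsLevel d → ∀ q ∈ D.primes, q ∉ d →
      (∃ c ∈ (D.atLevel 𝓕 d).selmerGroup, p • c = 0 ∧
        galoisCohomology.localization ρ (Sum.inr q) 1 c ≠ 0) →
      (∃ c' ∈ X d, p • c' = 0 ∧ galoisCohomology.localization ρ' (Sum.inr q) 1 c' ≠ 0) →
      Nat.card ↥(X (insert q d) ⊓ (nsmulAddMonoidHom p).ker) <
        Nat.card ↥(X d ⊓ (nsmulAddMonoidHom p).ker))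
    (hprime : ∀ d, D.IsLevel d → ∀ c ∈ (D.atLevel 𝓕 d).selmerGroup, p • c = 0 → c ≠ 0 →
      ∀ c' ∈ X d, p • c' = 0 → c' ≠ 0 →
        ∃ q ∈ D.primes, q ∉ d ∧ galoisCohomology.localization ρ (Sum.inr q) 1 c ≠ 0 ∧
          galoisCohomology.localization ρ' (Sum.inr q) 1 c' ≠ 0)
    {κ : Finset (HeightOneSpectrum (𝓞 K)) → galoisCohomology ρ 1} (hκ : D.IsKolyvaginSystem 𝓕 κ)
    {k : ℕ} (hk : 2 * k ≤ m + 1) {d : Finset (HeightOneSpectrum (𝓞 K))} (hd : D.IsLevel d) :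
    ∃ e ∈ (D.atLevel 𝓕 d).selmerGroup, p ^ k • e = 0 ∧
      p ^ (m - k) • κ d = Nat.card ↥(X d ⊓ (nsmulAddMonoidHom (p ^ k)).ker) • e := by
  -- finiteness of the torsion pieces of `X`
  have hXf : ∀ d i, Finite ↥(X d ⊓ (nsmulAddMonoidHom (p ^ i)).ker) := fun d i => by
    haveI := hXfin d; exact finite_inf_left _ _
  have hXG : ∀ d i, ∀ y ∈ X d ⊓ (nsmulAddMonoidHom (p ^ i)).ker, p ^ m • y = 0 := by
    intro d i y hy
    rw [AddSubgroup.mem_inf] at hy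
    exact hXp _ y hy.1
  -- double induction: on `k`, then on `#X(d)[p]`
  induction k using Nat.strong_induction_on generalizing d with
  | _ k IHk =>
  suffices inner : ∀ n (d : Finset (HeightOneSpectrum (𝓞 K))), D.IsLevel d →
      Nat.card ↥(X d ⊓ (nsmulAddMonoidHom (p ^ 1)).ker) ≤ n →
      ∃ e ∈ (D.atLevel 𝓕 d).selmerGroup, p ^ k • e = 0 ∧
        p ^ (m - k) • κ d = Nat.card ↥(X d ⊓ (nsmulAddMonoidHom (p ^ k)).ker) • e from
    inner _ d hd le_rfl
  intro n
  induction n with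
  | zero =>
    intro d hd hle
    haveI := hXf d 1
    exact absurd hle (not_le.mpr Nat.card_pos)
  | succ n IHn =>
  intro d hd hle
  -- `k = 0`: trivial
  rcases Nat.eq_zero_or_pos k with rfl | hk1
  · refine ⟨0, zero_mem _, by simp, ?_⟩
    rw [Nat.sub_zero, hV, nsmul_zero]
  have hkm : k ≤ m := by omega
  haveI := hfin d
  haveI := hXf d k
  set N := Nat.card ↥(X d ⊓ (nsmulAddMonoidHom (p ^ k)).ker) with hN
  by_cases hcase : N < p ^ k
  · /- Case 1: `λ(d, T^*) = j < k` -/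
    obtain ⟨j, hj⟩ := exists_card_eq_prime_pow _ (hXG d k)
    rw [← hN] at hj
    have hjk : j < k := (Nat.pow_lt_pow_iff_right hp.out.one_lt).mp (hj ▸ hcase)
    -- the torsion filtration of `X d` is stable from `j` on
    have hstab : ∀ i, j ≤ i →
        X d ⊓ (nsmulAddMonoidHom (p ^ i)).ker = X d ⊓ (nsmulAddMonoidHom (p ^ k)).ker :=
      inf_ker_nsmul_eq_of_card_lt (X d) hjk (hN ▸ hj)
    have hXi : ∀ i, j ≤ i → Nat.card ↥(X d ⊓ (nsmulAddMonoidHom (p ^ i)).ker) = p ^ j := by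
      intro i hi; rw [hstab i hi, ← hN, hj]
    -- induction on `k`: `p^{m-j} κ_d = p^j • e' = 0`
    obtain ⟨e', -, he'j, hκe'⟩ := IHk j hjk (by omega) hd
    rw [hXi j le_rfl] at hκe'
    have hzero : p ^ (m - j) • κ d = 0 := by rw [hκe', he'j]
    -- `x = p^{m-k} κ_d` is killed by `p^{k-j}`
    have hxr : p ^ (k - j) • (p ^ (m - k) • κ d) = 0 := by
      rw [← mul_nsmul', ← pow_add, show k - j + (m - k) = m - j by omega, hzero]
    -- the counts of the multiples of `G = H¹_{𝓕(d)}`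
    have hGm : Nat.card ↥(D.atLevel 𝓕 d).selmerGroup = p ^ m * p ^ j := by
      have h := hcount d hd m le_rfl
      have hGeq : (D.atLevel 𝓕 d).selmerGroup ⊓ (nsmulAddMonoidHom (p ^ m)).ker =
          (D.atLevel 𝓕 d).selmerGroup :=
        inf_eq_left.mpr fun x _ => by rw [AddMonoidHom.mem_ker, nsmulAddMonoidHom_apply]; exact hV x
      rw [hXi m (by omega), hGeq] at h
      exact h
    have hmap : ∀ t, j ≤ t → t ≤ m →
        Nat.card ↥((D.atLevel 𝓕 d).selmerGroup.map (nsmulAddMonoidHom (p ^ t))) = p ^ (m - t) := by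
      intro t hjt htm
      refine card_map_nsmul_of_counts _ htm hGm ?_
      rw [hcount d hd t htm, hXi t hjt]
    -- Case 1 of Mazur–Rubin: `x ∈ p^{m-k+j} G`
    have hmem : p ^ (m - k) • κ d ∈
        (D.atLevel 𝓕 d).selmerGroup.map (nsmulAddMonoidHom (p ^ (m - k + j))) := by
      refine mem_map_nsmul_add_of_counts (p := p) (D.atLevel 𝓕 d).selmerGroup
        (a := m - k) (j := j) (r := k - j) (fun x _ => ?_) ?_ ?_ ?_ ?_ hxr
      · rw [show m - k + j + (k - j) = m by omega]; exact hV x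
      · rw [hmap (m - k) (by omega) (by omega)]; congr 1; omega
      · rw [hmap (m - k + (k - j)) (by omega) (by omega)]; congr 1; omega
      · rw [hmap (m - k + j) (by omega) (by omega)]; congr 1; omega
      · exact AddSubgroup.mem_map.2 ⟨κ d, hκ.mem_selmerGroup d hd, rfl⟩
    obtain ⟨g, hg, hgx⟩ := AddSubgroup.mem_map.1 hmem
    refine ⟨p ^ (m - k) • g, AddSubgroup.nsmul_mem _ hg _, ?_, ?_⟩
    · rw [← mul_nsmul', ← pow_add, show k + (m - k) = m by omega]
      exact hV g
    · rw [hj, ← hgx, nsmulAddMonoidHom_apply, ← mul_nsmul', ← pow_add, add_comm j]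
  · /- Case 2: `λ(d, T^*) ≥ k`: show `p^{m-k} κ_d = 0` -/
    push Not at hcase
    suffices h0 : p ^ (m - k) • κ d = 0 from ⟨0, zero_mem _, nsmul_zero _, by rw [h0, nsmul_zero]⟩
    by_contra hx0
    -- a non-zero `p`-torsion multiple `y = p^s x`
    have hxk : p ^ k • (p ^ (m - k) • κ d) = 0 := by
      rw [← mul_nsmul', ← pow_add, show k + (m - k) = m by omega]; exact hV _
    obtain ⟨s, hy0, hpy⟩ := exists_nsmul_ne_zero_and_prime_nsmul_eq_zero hxk hx0
    have hymem : p ^ s • (p ^ (m - k) • κ d) ∈ (D.atLevel 𝓕 d).selmerGroup :=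
      AddSubgroup.nsmul_mem _ (AddSubgroup.nsmul_mem _ (hκ.mem_selmerGroup d hd) _) _
    -- a non-zero `p`-torsion class of `X d`
    have hXne : X d ⊓ (nsmulAddMonoidHom (p ^ 1)).ker ≠ ⊥ := by
      intro hbot
      have hZ : X d ⊓ (nsmulAddMonoidHom (p ^ k)).ker = ⊥ := by
        refine eq_bot_of_prime_torsion_eq_bot (p := p) _ (hXG d k) fun z hz hpz => ?_
        have : z ∈ X d ⊓ (nsmulAddMonoidHom (p ^ 1)).ker :=
          AddSubgroup.mem_inf.2 ⟨(AddSubgroup.mem_inf.1 hz).1, by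
            rw [AddMonoidHom.mem_ker, nsmulAddMonoidHom_apply, pow_one]; exact hpz⟩
        rw [hbot] at this
        exact (AddSubgroup.mem_bot.1 this)
      have h1 : N = 1 := by rw [hN, hZ, AddSubgroup.card_bot]
      have : p ^ k ≤ 1 := h1 ▸ hcase
      have : 1 < p ^ k := Nat.one_lt_pow hk1.ne' hp.out.one_lt
      omega
    obtain ⟨c', hc', hc'0⟩ := (AddSubgroup.bot_or_exists_ne_zero _).resolve_left hXne
    have hc'1 : p • c' = 0 := by
      have h := (AddSubgroup.mem_inf.1 hc').2
      rwa [AddMonoidHom.mem_ker, nsmulAddMonoidHom_apply, pow_one] at h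
    -- the prime choice and the residual drop
    obtain ⟨q, hq, hqd, hyq, hc'q⟩ := hprime d hd _ hymem hpy hy0 c' (AddSubgroup.mem_inf.1 hc').1
      hc'1 hc'0
    have hlt := hdrop d hd q hq hqd ⟨_, hymem, hpy, hyq⟩ ⟨c', (AddSubgroup.mem_inf.1 hc').1, hc'1, hc'q⟩
    -- induction on `#X(d)[p]`: the stub shape at `d𝔮`
    have hle' : Nat.card ↥(X (insert q d) ⊓ (nsmulAddMonoidHom (p ^ 1)).ker) ≤ n := by
      rw [pow_one]; rw [pow_one] at hle; omega
    obtain ⟨e, he, hek, hκe⟩ := IHn (insert q d) (hd.insert hq) hle'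
    -- Lemma 4.2.1: `loc_𝔮 x = 0`, contradicting `loc_𝔮 y ≠ 0`
    have hloc := localization_nsmul_apply_eq_zero_of_stub h𝓕 hPS hadm hUT hfin X hXfin hXp hκ hd hq
      hqd (hUk q hq k hkm) (hcount d hd k hkm) (hcount _ (hd.insert hq) k hkm) (hN ▸ hcase) he hek hκe
    apply hyq
    rw [map_nsmul, hloc, nsmul_zero]

end StubLift

end Summit.BirchSwinnertonDyer.BirchSwinnertonDyer.Theorems.KimAtThreeDeepUpperStubLiftable

end
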